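import Summits.ResolutionOfSingularities.ResolutionOfSingularities.Theses.MaxContactCut
import Summits.ResolutionOfSingularities.ResolutionOfSingularities.Theorems.HugDimensionClasses
import Summits.ResolutionOfSingularities.ResolutionOfSingularities.Theorems.HugDimensionKernels
import Summits.ResolutionOfSingularities.ResolutionOfSingularities.Theorems.MaxContactCutForcedTowers
import Summits.ResolutionOfSingularities.ResolutionOfSingularities.Theorems.MaxContactCutDivergentTowers
import Summits.ResolutionOfSingularities.ResolutionOfSingularities.Theorems.MaxContactCutMonomialTowers
import HarnessLib

/-!
# MaxContactCutHugDimension — the g10 node «HugDimension» wired to the route MaxContactCut BY NAME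
(decomp-res node N54, lens-4 g10 rev 2 sha256 ee3232b051ee315d; CRITIC-LEDGER row 64 CLEARED AS MAP NODE; phase 3 of 3)

Vocabulary and paper proofs: `Theorems/HugDimensionClasses` (the intrinsic predicate `EventuallyMonomial`, the hugged
germ of MINIMAL DIMENSION `w` (`HugsGermOfDim`), the pieces `MonomialTowersTerminate` / `NonMonomialTowersTerminate`
/ `CurveHuggingTowersTerminate` / `SurfaceHuggingTowersTerminate` / `HypersurfaceHuggingTowersTerminate` with their
EXACT calculus, the ports `TransversalMonomial` / `MonomialCorner` / `GeneratorHugging` / `CurveLaw` / `EternalBound`);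
proved kernels: `Theorems/HugDimensionKernels`.  Route asides (MaxContactCut, `aside · rank 9`, refining the tower
residual `NoHuggingTowers` 31570 and `NoForcedTowers` 30253): `NoMonomialTowers` [DECIDED-MOD-PORT(KNOWN): port
`MonomialCornerAll` + the tree's combinatorial leaf `NoCornerTower d n, d ≤ 4`; absorbs the boundary-hugging monomial
towers of 31571], `NoNonMonomialTowers` [THE LOCATED RESIDUAL, ≡ 31570 ≡ 30253 modulo the decided pieces],
`NoCurveHuggingTowers` [DECIDED-MOD-PORT by `CurveLawAll`, elementary, all `k`], `NoSurfaceHuggingTowers` [w = 2: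
UNDECIDED · ATTACKABLE · INSTRUMENTABLE], `NoHypersurfaceHuggingTowers` [w = 3: UNDECIDED · IDEA-NEEDED], and the port
asides `MonomialCornerAll` / `GeneratorHuggingAll` / `CurveLawAll`.

Kernels (all by name, 0 sorry): 31570 from the pieces (`noHuggingTowers_of_pieces`), THE ONE EQUIV
`noHuggingTowers_iff_nonMonomial` (31570 ⟺ residual modulo decided pieces), 31570 / 30253 from the decided pieces and
the two `w`-leaves (`noHuggingTowers_of_leaves`, `noForcedTowers_of_leaves`), 31571 / 31572 from the restricted
leaves, 31569 inside the monomial piece, the edge 31573 → 31261 between TREE items is the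
landed `MaxContactCutMonomialTowers.noCoreValuativeTowers_of_cornerNormalForm` (critic's cheap theorem #24, reused, not
restated), 31260 and 30257 from the pieces, necessity
without ports (`pieces_of_noForcedTowers`), and the upward edges to `E 1`, `RungOne` 29273 and the located core 28544
through the landed `MaxContactCutForcedTowers` / `MaxContactCutDivergentTowers` kernels.  ROOT BY NAME is the route's
`closes`.  WHY THIS IS NOVEL (critic row 64): the residual of the tower side is re-cut by the INTRINSIC monomiality of
the controlled transform (no chart, no hugging hypothesis) and then by the minimal dimension `w` of a hugged germ,
with `w = 1` killed for every residue field by an elementary `t`-adic descent (`CurveLaw`, twin of CJS Thm 6.35) — the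
bed lives in `w ∈ {2, 3}`.  (Sources: CossartJannsenSaito2020 Thm 6.35 / Cor. 6.37; BierstoneGrigorievMilmanWlodarczyk2011
§3; Blanco arXiv:0902.2887; Shannon1973; HeinzerOlberdingToeniskoetter2017; Hartshorne1977 II.7.)
-/

set_option autoImplicit false

namespace Summit.ResolutionOfSingularities.ResolutionOfSingularities.Theorems.MaxContactCutHugDimension

open CategoryTheory AlgebraicGeometry
open Literature.AlgebraicGeometry.Resolution
open Summit.ResolutionOfSingularities.ResolutionOfSingularities.Theses
open Summit.ResolutionOfSingularities.ResolutionOfSingularities.Theorems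
open WeakOrderReduction ForcedTowerClasses DivergentTowerClasses MonomialTowerClasses
open HugDimensionClasses HugDimensionKernels

/-! ## The asides unfolded -/

/-- `NoMonomialTowers` is the monomial piece at every marking. [folklore] -/
theorem noMonomialTowers_iff :
    MaxContactCut.NoMonomialTowers ↔ ∀ n : ℕ, 1 ≤ n → MonomialTowersTerminate n := Iff.rfl

/-- `NoNonMonomialTowers` is the located residual at every marking. [folklore] -/
theorem noNonMonomialTowers_iff :
    MaxContactCut.NoNonMonomialTowers ↔ ∀ n : ℕ, 1 ≤ n → NonMonomialTowersTerminate n := Iff.rfl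

/-- `NoCurveHuggingTowers` is the `w = 1` leaf at every marking. [folklore] -/
theorem noCurveHuggingTowers_iff :
    MaxContactCut.NoCurveHuggingTowers ↔ ∀ n : ℕ, 1 ≤ n → CurveHuggingTowersTerminate n := Iff.rfl

/-- `NoSurfaceHuggingTowers` is the `w = 2` leaf at every marking. [folklore] -/
theorem noSurfaceHuggingTowers_iff :
    MaxContactCut.NoSurfaceHuggingTowers ↔ ∀ n : ℕ, 1 ≤ n → SurfaceHuggingTowersTerminate n := Iff.rfl

/-- `NoHypersurfaceHuggingTowers` is the `w = 3` leaf at every marking. [folklore] -/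
theorem noHypersurfaceHuggingTowers_iff :
    MaxContactCut.NoHypersurfaceHuggingTowers ↔ ∀ n : ℕ, 1 ≤ n → HypersurfaceHuggingTowersTerminate n := Iff.rfl

/-- `MonomialCornerAll` is the port `MonomialCorner` at every marking. [folklore] -/
theorem monomialCornerAll_iff : MaxContactCut.MonomialCornerAll ↔ ∀ n : ℕ, 1 ≤ n → MonomialCorner n := Iff.rfl

/-- `GeneratorHuggingAll` is the structure port `GeneratorHugging` at every marking. [folklore] -/
theorem generatorHuggingAll_iff : MaxContactCut.GeneratorHuggingAll ↔ ∀ n : ℕ, 1 ≤ n → GeneratorHugging n :=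
  Iff.rfl

/-- `CurveLawAll` is the port `CurveLaw` at every marking. [folklore] -/
theorem curveLawAll_iff : MaxContactCut.CurveLawAll ↔ ∀ n : ℕ, 1 ≤ n → CurveLaw n := Iff.rfl

/-! ## Up to the booked MaxContactCut items BY NAME (31569 / 31570 / 31571 / 31572 / 31573 / 31260 / 31261 / 30253 /
30257 / 29273 / 28544) -/

/-- **THE TARGET 31570 `MaxContactCut.NoHuggingTowers` BY NAME from the pieces** (port `MonomialCorner` + combinatorial
leaf + residual). [folklore] -/
theorem noHuggingTowers_of_pieces (hM : MaxContactCut.MonomialCornerAll) (hC : NoCornerTowers)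
    (hN : MaxContactCut.NoNonMonomialTowers) : MaxContactCut.NoHuggingTowers :=
  fun n hn => hugging_of_nonMonomial (hM n hn) (hC n hn) (hN n hn)

/-- **THE ONE EQUIV, modulo the decided pieces: `MaxContactCut.NoHuggingTowers ⟺
MaxContactCut.NoNonMonomialTowers`.** [folklore] -/
theorem noHuggingTowers_iff_nonMonomial (hTM : ∀ n, 1 ≤ n → TransversalMonomial n)
    (hM : MaxContactCut.MonomialCornerAll) (hC : NoCornerTowers) :
    MaxContactCut.NoHuggingTowers ↔ MaxContactCut.NoNonMonomialTowers :=
  ⟨fun h n hn => nonMonomial_of_hugging (hTM n hn) (h n hn), noHuggingTowers_of_pieces hM hC⟩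

/-- **31570 from the decided pieces and the two `w`-leaves.** [folklore] -/
theorem noHuggingTowers_of_leaves (hM : MaxContactCut.MonomialCornerAll) (hC : NoCornerTowers)
    (hL : MaxContactCut.CurveLawAll) (hS : MaxContactCut.NoSurfaceHuggingTowers)
    (hH : MaxContactCut.NoHypersurfaceHuggingTowers) : MaxContactCut.NoHuggingTowers :=
  noHuggingTowers_of_pieces hM hC fun n hn => nonMonomial_of_leaves (curve_of_curveLaw (hL n hn)) (hS n hn) (hH n hn)

/-- **31571 `MaxContactCut.NoContactHuggingTowers` BY NAME** from the restricted contact leaf + the monomial ports.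
[folklore] -/
theorem noContactHuggingTowers_of_pieces (hM : MaxContactCut.MonomialCornerAll) (hC : NoCornerTowers)
    (h : NoNonMonomialContactTowers) : MaxContactCut.NoContactHuggingTowers :=
  fun n hn => contact_of_pieces (hM n hn) (hC n hn) (h n hn)

/-- **31572 `MaxContactCut.NoWildHuggingTowers` BY NAME** from the restricted wild leaf + the monomial ports.
[folklore] -/
theorem noWildHuggingTowers_of_pieces (hM : MaxContactCut.MonomialCornerAll) (hC : NoCornerTowers)
    (h : NoNonMonomialWildTowers) : MaxContactCut.NoWildHuggingTowers :=
  fun n hn => wild_of_pieces (hM n hn) (hC n hn) (h n hn)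

/-- **31569 `MaxContactCut.NoTransversalTowers` BY NAME lies INSIDE the monomial piece** (mod `TransversalMonomial`).
[folklore] -/
theorem noTransversalTowers_of_monomial (hTM : ∀ n, 1 ≤ n → TransversalMonomial n) (h : MaxContactCut.NoMonomialTowers) :
    MaxContactCut.NoTransversalTowers :=
  fun n hn => transversal_of_monomial (hTM n hn) (h n hn)

/-- **30253 `MaxContactCut.NoForcedTowers` from the same pieces** (one item up). [folklore] -/
theorem noForcedTowers_of_pieces (hM : MaxContactCut.MonomialCornerAll) (hC : NoCornerTowers)
    (hN : MaxContactCut.NoNonMonomialTowers) : MaxContactCut.NoForcedTowers :=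
  fun n hn => ftt_of_nonMonomial (hM n hn) (hC n hn) (hN n hn)

/-- The same equivalence one item up (same layer): `MaxContactCut.NoForcedTowers ⟺
MaxContactCut.NoNonMonomialTowers` modulo the
decided pieces (port-free necessity). [folklore] -/
theorem noForcedTowers_iff_nonMonomial (hM : MaxContactCut.MonomialCornerAll) (hC : NoCornerTowers) :
    MaxContactCut.NoForcedTowers ↔ MaxContactCut.NoNonMonomialTowers :=
  ⟨fun h n hn => (HugDimensionClasses.allPieces_of_ftt (h n hn)).2.2.2.1, noForcedTowers_of_pieces hM hC⟩

/-- **30253 from the decided pieces and the two `w`-leaves.** [folklore] -/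
theorem noForcedTowers_of_leaves (hM : MaxContactCut.MonomialCornerAll) (hC : NoCornerTowers)
    (hL : MaxContactCut.CurveLawAll) (hS : MaxContactCut.NoSurfaceHuggingTowers)
    (hH : MaxContactCut.NoHypersurfaceHuggingTowers) : MaxContactCut.NoForcedTowers :=
  fun n hn => ftt_of_leaves (hM n hn) (hC n hn) (hL n hn) (hS n hn) (hH n hn)

/-- Necessity without any port: `NoForcedTowers → every piece` (incl. the tree's 31569 / 31570). [folklore] -/
theorem pieces_of_noForcedTowers (h : MaxContactCut.NoForcedTowers) :
    MaxContactCut.NoTransversalTowers ∧ MaxContactCut.NoHuggingTowers ∧ MaxContactCut.NoMonomialTowers ∧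
      MaxContactCut.NoNonMonomialTowers ∧ MaxContactCut.NoCurveHuggingTowers ∧ MaxContactCut.NoSurfaceHuggingTowers ∧
        MaxContactCut.NoHypersurfaceHuggingTowers ∧ NoNonMonomialContactTowers ∧ NoNonMonomialWildTowers :=
  ⟨fun n hn => (HugDimensionClasses.allPieces_of_ftt (h n hn)).1,
    fun n hn => (HugDimensionClasses.allPieces_of_ftt (h n hn)).2.1,
    fun n hn => (HugDimensionClasses.allPieces_of_ftt (h n hn)).2.2.1,
    fun n hn => (HugDimensionClasses.allPieces_of_ftt (h n hn)).2.2.2.1,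
    fun n hn => (HugDimensionClasses.allPieces_of_ftt (h n hn)).2.2.2.2,
    fun n hn => (HugDimensionClasses.leaves_of_ftt (h n hn)).1,
    fun n hn => (HugDimensionClasses.leaves_of_ftt (h n hn)).2.1,
    fun n hn => (HugDimensionClasses.leaves_of_ftt (h n hn)).2.2.1,
    fun n hn => (HugDimensionClasses.leaves_of_ftt (h n hn)).2.2.2⟩

/-- Necessity at the residual level, modulo `TransversalMonomial` only: `NoHuggingTowers → the residual and all its
leaves`. [folklore] -/
theorem pieces_of_noHuggingTowers (hTM : ∀ n, 1 ≤ n → TransversalMonomial n) (h : MaxContactCut.NoHuggingTowers) :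
    MaxContactCut.NoNonMonomialTowers ∧ MaxContactCut.NoSurfaceHuggingTowers ∧
      MaxContactCut.NoHypersurfaceHuggingTowers ∧ NoNonMonomialContactTowers ∧ NoNonMonomialWildTowers := by
  have hN : MaxContactCut.NoNonMonomialTowers := fun n hn => nonMonomial_of_hugging (hTM n hn) (h n hn)
  exact ⟨hN, fun n hn => (nonMonomial_iff_leaves.mp (hN n hn)).2.1, fun n hn => (nonMonomial_iff_leaves.mp (hN n hn)).2.2,
    fun n hn => (nonMonomial_iff_contact_wild.mp (hN n hn)).1, fun n hn => (nonMonomial_iff_contact_wild.mp (hN n hn)).2⟩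

/-- The combinatorial leaf in MaxContactCut shape from the tree's bookkeeping ports. [folklore] -/
theorem noCornerTowers_of_model (hR : ∀ n, 1 ≤ n → CornerModel n) (hT : ∀ n, 1 ≤ n → TowerObstructs n) :
    NoCornerTowers :=
  fun n hn => noCornerTower_of_model (hR n hn) (hT n hn)

/-- … and g8's valuative leaf in `∀ n ≥ 1` shape (fourth conjunct of the tree's `noForcedTowers_iff_ttLeaves`), every
`k`. [folklore] -/
theorem valuativeAll_of_cornerNormalFormAll (hX : MaxContactCut.CornerNormalFormAll) :
    ∀ n : ℕ, 1 ≤ n → ValuativeTowersTerminate n :=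
  fun n hn => valuative_of_cornerNormalFormPlus hn (hX n hn)

/-- **BY NAME: the TREE ITEM 31260 `MaxContactCut.NoCoreGermHuggingTowers` from the monomial ports + residual.**
[folklore] -/
theorem noCoreGermHuggingTowers_of_pieces (hM : MaxContactCut.MonomialCornerAll) (hC : NoCornerTowers)
    (hN : MaxContactCut.NoNonMonomialTowers) : MaxContactCut.NoCoreGermHuggingTowers :=
  fun n hn => coreGermHugging_of_pieces (hM n hn) (hC n hn) (hN n hn)

/-- The TREE's residual 31570 implies g10's: `MaxContactCut.NoHuggingTowers → MaxContactCut.NoNonMonomialTowers` modulo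
`TransversalMonomial` (the g10 residual is NOT larger than g9's). [folklore] -/
theorem noNonMonomialTowers_of_noHuggingTowers' (hTM : ∀ n, 1 ≤ n → TransversalMonomial n)
    (hH : MaxContactCut.NoHuggingTowers) : MaxContactCut.NoNonMonomialTowers :=
  fun n hn => nonMonomial_of_hugging (hTM n hn) (hH n hn)

/-- … or modulo the structure port `GeneratorHugging`. [folklore] -/
theorem noNonMonomialTowers_of_noHuggingTowers (hG : MaxContactCut.GeneratorHuggingAll)
    (hH : MaxContactCut.NoHuggingTowers) : MaxContactCut.NoNonMonomialTowers :=
  noNonMonomialTowers_of_noHuggingTowers' (fun n hn => transversalMonomial_of_generatorHugging (hG n hn)) hH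

/-- **30253 from the TREE's hugging residual 31570 through the g10 ports** (`GeneratorHugging` + `MonomialCorner`
replace g9's `CornerNormalForm` on the transversal side). [folklore] -/
theorem noForcedTowers_of_hugging (hG : MaxContactCut.GeneratorHuggingAll) (hM : MaxContactCut.MonomialCornerAll)
    (hC : NoCornerTowers) (hH : MaxContactCut.NoHuggingTowers) : MaxContactCut.NoForcedTowers :=
  noForcedTowers_of_pieces hM hC (noNonMonomialTowers_of_noHuggingTowers hG hH)

/-- The monomial aside from its ports, in MaxContactCut shape. [folklore] -/
theorem noMonomialTowers_of_ports (hM : MaxContactCut.MonomialCornerAll) (hC : NoCornerTowers) : MaxContactCut.NoMonomialTowers :=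
  fun n hn => monomial_of_ports (hM n hn) (hC n hn)

/-- The curve aside from the curve law, in MaxContactCut shape. [folklore] -/
theorem noCurveHuggingTowers_of_curveLaw (hL : MaxContactCut.CurveLawAll) : MaxContactCut.NoCurveHuggingTowers :=
  fun n hn => curve_of_curveLaw (hL n hn)

/-- **BY NAME: 30257 `MaxContactCut.NoGrowingTowers` lives INSIDE the non-monomial class** (mod `MonomialCorner`).
[folklore] -/
theorem noGrowingTowers_of_nonMonomial (hM : MaxContactCut.MonomialCornerAll)
    (h : ∀ n, 1 ≤ n → NoTower n fun T => ¬ EventuallyMonomial T ∧ ¬ T.EventuallyStationary) :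
    MaxContactCut.NoGrowingTowers :=
  fun n hn => growing_of_nonMonomial (hM n hn) (h n hn)

/-- **`E 1` from the node**: row-47 ports + `MonomialCorner` + combinatorial leaf + residual + the nowhere-isolated
aside (30254). [folklore] -/
theorem e_one_of_pieces (hS : ∀ n, 1 ≤ n → ForcedSeed n) (hD : ∀ n, 1 ≤ n → ForcedDescent n)
    (hM : MaxContactCut.MonomialCornerAll) (hC : NoCornerTowers) (hN : MaxContactCut.NoNonMonomialTowers)
    (hNI : MaxContactCut.NowhereIsolatedReduction) : E 1 :=
  MaxContactCutForcedTowers.e_one_of_forced hS hD (noForcedTowers_of_pieces hM hC hN) hNI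

/-- **RungOne (29273) BY NAME.** [folklore] -/
theorem rungOne_of_pieces (hS : ∀ n, 1 ≤ n → ForcedSeed n) (hD : ∀ n, 1 ≤ n → ForcedDescent n)
    (hM : MaxContactCut.MonomialCornerAll) (hC : NoCornerTowers) (hN : MaxContactCut.NoNonMonomialTowers)
    (hNI : MaxContactCut.NowhereIsolatedReduction) : MaxContactCut.RungOne :=
  MaxContactCutForcedTowers.rungOne_of_e_one (e_one_of_pieces hS hD hM hC hN hNI)

/-- **The located dim-4 core 28544 `MaxContactCut.StepPICoreDimFour` BY NAME** (landed `core_of_forced`). [folklore] -/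
theorem core_of_pieces (hS : ∀ n, 1 ≤ n → ForcedSeed n) (hD : ∀ n, 1 ≤ n → ForcedDescent n)
    (hM : MaxContactCut.MonomialCornerAll) (hC : NoCornerTowers) (hN : MaxContactCut.NoNonMonomialTowers)
    (hNI : MaxContactCut.NowhereIsolatedReduction) (hStep : MaxContactCut.SequenceToStepAll) :
    MaxContactCut.StepPICoreDimFour :=
  MaxContactCutForcedTowers.core_of_forced hS hD (noForcedTowers_of_pieces hM hC hN) hNI hStep

/-- The core from ALL ports (row 47's three + `MonomialCorner` + `CornerModel` + `CurveLaw`) and the two UNDECIDED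
`w`-leaves. [folklore] -/
theorem core_of_leaves (hS : ∀ n, 1 ≤ n → ForcedSeed n) (hD : ∀ n, 1 ≤ n → ForcedDescent n)
    (hT : ∀ n, 1 ≤ n → TowerObstructs n) (hM : MaxContactCut.MonomialCornerAll)
    (hR : ∀ n, 1 ≤ n → CornerModel n) (hL : MaxContactCut.CurveLawAll) (h₂ : MaxContactCut.NoSurfaceHuggingTowers)
    (h₃ : MaxContactCut.NoHypersurfaceHuggingTowers) (hNI : MaxContactCut.NowhereIsolatedReduction)
    (hStep : MaxContactCut.SequenceToStepAll) : MaxContactCut.StepPICoreDimFour :=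
  core_of_pieces hS hD hM (noCornerTowers_of_model hR hT)
    (fun n hn => nonMonomial_of_leaves (curve_of_curveLaw (hL n hn)) (h₂ n hn) (h₃ n hn)) hNI hStep

/-- EXACT modulo all ports: `E 1 ⟺ MaxContactCut.NoNonMonomialTowers ∧ NowhereIsolatedReduction`. [folklore] -/
theorem e_one_iff_nonMonomial (hS : ∀ n, 1 ≤ n → ForcedSeed n) (hD : ∀ n, 1 ≤ n → ForcedDescent n)
    (hT : ∀ n, 1 ≤ n → TowerObstructs n) (hM : MaxContactCut.MonomialCornerAll)
    (hR : ∀ n, 1 ≤ n → CornerModel n) :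
    E 1 ↔ MaxContactCut.NoNonMonomialTowers ∧ MaxContactCut.NowhereIsolatedReduction := by
  rw [MaxContactCutForcedTowers.e_one_iff_forced hS hD hT,
    noForcedTowers_iff_nonMonomial hM (noCornerTowers_of_model hR hT)]

/-- RungOne located (29273) through the TREE's g8 kernel `MaxContactCutDivergentTowers.rungOne_of_located'`: the two
CORE asides it consumes are supplied here (31261 by the tree's 31573, 31260 by the monomial ports + residual).
[folklore] -/
theorem rungOne_of_located (hS : ∀ n, 1 ≤ n → ForcedSeed n) (hD : ∀ n, 1 ≤ n → ForcedDescent n)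
    (hP : ∀ n, 1 ≤ n → ClassTwoTailsDie n) (hF : MaxContactCut.NoEventuallyFreeTowers)
    (hX : MaxContactCut.CornerNormalFormAll) (hM : MaxContactCut.MonomialCornerAll) (hC : NoCornerTowers)
    (hN : MaxContactCut.NoNonMonomialTowers) (hNI : MaxContactCut.NowhereIsolatedReduction) : MaxContactCut.RungOne :=
  MaxContactCutDivergentTowers.rungOne_of_located' hS hD hP hF (noCoreGermHuggingTowers_of_pieces hM hC hN)
    (MaxContactCutMonomialTowers.noCoreValuativeTowers_of_cornerNormalForm hX) hNI

end Summit.ResolutionOfSingularities.ResolutionOfSingularities.Theorems.MaxContactCutHugDimension
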